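import Summits.Langlands.Langlands.Theorems.EisensteinMonodromyEnvelopeCompression
import Literature.NumberTheory.GaloisRepresentations.WeilDeligneOfGalois
import Literature.NumberTheory.GaloisRepresentations.WeilGroupFrobeniusPowers
import HarnessLib

/-!
# EisensteinMonodromy — compressed Weil–Deligne representations and recipe transfer

Local half of the proof of `Summit.Langlands.Langlands.Theses.EisensteinMonodromy.EnvelopeToTarget`
(stmt-Langlands-2375), continuing `EisensteinMonodromyEnvelopeCompression` (§1–§3):

* §4 the compressed Weil–Deligne representation `compress W I P` of a Weil–Deligne representation
  `W` on `Fin m → E` whose `ρ(w)` and `N` commute with the idempotent `e = I P` (`P I = 1`), and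
  GENERICITY TRANSFER `isGeneric_compress` (`Hom_WD(W, W(1)) = 0 ⇒ Hom_WD(W', W'(1)) = 0`, Allen
  2016 Def. 1.1.2, by inflating a twisted endomorphism `f` of the compression to `I f P`); the
  genericity clause is written inline, literally as in the route statements;
* §5 RECIPE TRANSFER `exists_isWeilDeligneOfLadic_of_summand`: if `W` is attached to
  `R : W_F →* GL_m(E)` by the Grothendieck–Deligne recipe `IsWeilDeligneOfLadic` and
  `ρ' : W_F →* GL_n(E)` is a summand of `R` cut out by `(I, P)` (`R w * I = I * ρ' w`,
  `P * R w = ρ' w * P`), then the compression is attached to `ρ'` by the SAME recipe datum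
  `(t, U, Φ)`, and it is generic if `W` is.  The one non-formal point: `e` commutes with the
  monodromy `N` because it commutes with `R u₀ = exp (t(u₀) N)`, `t(u₀) ≠ 0` (key lemma §3).

References: Deligne, Antwerp II (1973) §8; Tate, Corvallis (1979) §4.1–4.2.
[cite: TateCorvallis1979, (4.2.1)]
-/

set_option linter.dupNamespace false

noncomputable section

namespace Summit.Langlands.Langlands.Theorems.EisensteinMonodromyEnvelopeCompression

open Literature.NumberTheory.GaloisRepresentations
open Literature.NumberTheory.GaloisRepresentations.IsNonarchimedeanLocalField (residueFieldCard)
open Literature.NumberTheory.GaloisRepresentations.WeilGroup (deg inertia)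

/-! ### §4 Compressed Weil–Deligne representations and genericity transfer -/

section WD

variable {F : Type*} [Field F] [ValuativeRel F] [TopologicalSpace F] [IsNonarchimedeanLocalField F]
variable {E : Type*} [Field E] [CharZero E] {m n : ℕ}
variable (W : WeilDeligneRep F E (Fin m → E)) (I : Matrix (Fin m) (Fin n) E)
  (P : Matrix (Fin n) (Fin m) E)

/-- The Weil–Deligne relation of `W` in matrix form. [cite: TateCorvallis1979, (4.1.2)] -/
theorem toMatrix'_conj_N (w : WeilGroup F) :
    LinearMap.toMatrix' (W.ρ w) * LinearMap.toMatrix' W.N =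
      ((residueFieldCard F : E) ^ deg w) • (LinearMap.toMatrix' W.N * LinearMap.toMatrix' (W.ρ w)) := by
  have h := congrArg LinearMap.toMatrix' (W.conj_N w)
  rwa [LinearMap.toMatrix'_comp, map_smul, LinearMap.toMatrix'_comp] at h

/-- The compressed Weil action `w ↦ P ρ(w) I` (a homomorphism because `ρ(w)` commutes with
`e = I P`). [folklore] -/
def compressρ (hPI : P * I = 1)
    (hρ : ∀ w, I * P * LinearMap.toMatrix' (W.ρ w) = LinearMap.toMatrix' (W.ρ w) * (I * P)) :
    Representation E (WeilGroup F) (Fin n → E) :=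
  (Matrix.toLinAlgEquiv' : Matrix (Fin n) (Fin n) E ≃ₐ[E] Module.End E (Fin n → E)).toMonoidHom.comp
    { toFun := fun w => P * LinearMap.toMatrix' (W.ρ w) * I
      map_one' := by rw [map_one, LinearMap.toMatrix'_one, Matrix.mul_one, hPI]
      map_mul' := fun w w' => by rw [map_mul, LinearMap.toMatrix'_mul, compress_mul hPI _ (hρ w')] }

/-- Unfolding `compressρ`. [folklore] -/
theorem compressρ_apply (hPI : P * I = 1)
    (hρ : ∀ w, I * P * LinearMap.toMatrix' (W.ρ w) = LinearMap.toMatrix' (W.ρ w) * (I * P))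
    (w : WeilGroup F) :
    compressρ W I P hPI hρ w = Matrix.toLin' (P * LinearMap.toMatrix' (W.ρ w) * I) := rfl

/-- Matrix of the compressed Weil action. [folklore] -/
theorem toMatrix'_compressρ (hPI : P * I = 1)
    (hρ : ∀ w, I * P * LinearMap.toMatrix' (W.ρ w) = LinearMap.toMatrix' (W.ρ w) * (I * P))
    (w : WeilGroup F) :
    LinearMap.toMatrix' (compressρ W I P hPI hρ w) = P * LinearMap.toMatrix' (W.ρ w) * I := by
  rw [compressρ_apply, LinearMap.toMatrix'_toLin']

/-- **The compressed Weil–Deligne representation** `(P ρ I, P N I)` on `Fin n → E` of a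
Weil–Deligne representation `(ρ, N)` on `Fin m → E` whose `ρ(w)` and `N` commute with the
idempotent `e = I P` (`P I = 1`). [folklore] -/
def compress (hPI : P * I = 1)
    (hρ : ∀ w, I * P * LinearMap.toMatrix' (W.ρ w) = LinearMap.toMatrix' (W.ρ w) * (I * P))
    (hN : I * P * LinearMap.toMatrix' W.N = LinearMap.toMatrix' W.N * (I * P)) :
    WeilDeligneRep F E (Fin n → E) where
  ρ := compressρ W I P hPI hρ
  isContinuous := by
    obtain ⟨U, hU, hUo, hU1⟩ := W.isContinuous
    refine ⟨U, hU, hUo, fun u hu => ?_⟩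
    rw [compressρ_apply, hU1 u hu, LinearMap.toMatrix'_one, Matrix.mul_one, hPI, Matrix.toLin'_one]
    rfl
  N := Matrix.toLin' (P * LinearMap.toMatrix' W.N * I)
  isNilpotent_N :=
    (isNilpotent_compress hPI hN (W.isNilpotent_N.map LinearMap.toMatrixAlgEquiv')).map
      Matrix.toLinAlgEquiv'
  conj_N := fun w => by
    apply LinearMap.toMatrix'.injective
    have key : P * LinearMap.toMatrix' (W.ρ w) * I * (P * LinearMap.toMatrix' W.N * I) =
        ((residueFieldCard F : E) ^ deg w) •
          (P * LinearMap.toMatrix' W.N * I * (P * LinearMap.toMatrix' (W.ρ w) * I)) := by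
      rw [← compress_mul hPI _ hN, ← compress_mul hPI _ (hρ w), toMatrix'_conj_N, Matrix.mul_smul,
        Matrix.smul_mul]
    rw [LinearMap.toMatrix'_comp, LinearEquiv.map_smul, LinearMap.toMatrix'_comp,
      toMatrix'_compressρ, LinearMap.toMatrix'_toLin', key]

/-- The monodromy of the compression, as a matrix. [folklore] -/
theorem toMatrix'_compress_N (hPI : P * I = 1)
    (hρ : ∀ w, I * P * LinearMap.toMatrix' (W.ρ w) = LinearMap.toMatrix' (W.ρ w) * (I * P))
    (hN : I * P * LinearMap.toMatrix' W.N = LinearMap.toMatrix' W.N * (I * P)) :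
    LinearMap.toMatrix' (compress W I P hPI hρ hN).N = P * LinearMap.toMatrix' W.N * I :=
  LinearMap.toMatrix'_toLin' _

/-- The Weil action of the compression, as a matrix. [folklore] -/
theorem toMatrix'_compress_ρ (hPI : P * I = 1)
    (hρ : ∀ w, I * P * LinearMap.toMatrix' (W.ρ w) = LinearMap.toMatrix' (W.ρ w) * (I * P))
    (hN : I * P * LinearMap.toMatrix' W.N = LinearMap.toMatrix' W.N * (I * P)) (w : WeilGroup F) :
    LinearMap.toMatrix' ((compress W I P hPI hρ hN).ρ w) = P * LinearMap.toMatrix' (W.ρ w) * I :=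
  toMatrix'_compressρ W I P hPI hρ w

/-- **Genericity transfer.** If `W` is generic (`Hom_WD(W, W(1)) = 0`, Allen 2016 Def. 1.1.2)
then so is its compression: a twisted endomorphism `f` of the compression inflates to the twisted
endomorphism `I f P` of `W`. [cite: Allen2016, Def. 1.1.2] -/
theorem isGeneric_compress (hPI : P * I = 1)
    (hρ : ∀ w, I * P * LinearMap.toMatrix' (W.ρ w) = LinearMap.toMatrix' (W.ρ w) * (I * P))
    (hN : I * P * LinearMap.toMatrix' W.N = LinearMap.toMatrix' W.N * (I * P))
    (hgen : ∀ f : (Fin m → E) →ₗ[E] (Fin m → E),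
      (∀ w : WeilGroup F, f ∘ₗ W.ρ w = ((residueFieldCard F : E) ^ (deg w)) • (W.ρ w ∘ₗ f)) →
        f ∘ₗ W.N = W.N ∘ₗ f → f = 0) :
    ∀ f : (Fin n → E) →ₗ[E] (Fin n → E),
      (∀ w : WeilGroup F, f ∘ₗ (compress W I P hPI hρ hN).ρ w =
          ((residueFieldCard F : E) ^ (deg w)) • ((compress W I P hPI hρ hN).ρ w ∘ₗ f)) →
        f ∘ₗ (compress W I P hPI hρ hN).N = (compress W I P hPI hρ hN).N ∘ₗ f → f = 0 := by
  intro f hf hfN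
  set fm := LinearMap.toMatrix' f with hfm
  -- matrix forms of the hypotheses on `f`
  have hf' : ∀ w, fm * (P * LinearMap.toMatrix' (W.ρ w) * I) =
      ((residueFieldCard F : E) ^ deg w) • (P * LinearMap.toMatrix' (W.ρ w) * I * fm) := by
    intro w
    have h := congrArg LinearMap.toMatrix' (hf w)
    rwa [LinearMap.toMatrix'_comp, LinearEquiv.map_smul, LinearMap.toMatrix'_comp,
      toMatrix'_compress_ρ] at h
  have hfN' : fm * (P * LinearMap.toMatrix' W.N * I) = P * LinearMap.toMatrix' W.N * I * fm := by
    have h := congrArg LinearMap.toMatrix' hfN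
    rwa [LinearMap.toMatrix'_comp, LinearMap.toMatrix'_comp, toMatrix'_compress_N] at h
  -- the inflated map `g = I f P`
  set g : (Fin m → E) →ₗ[E] (Fin m → E) := Matrix.toLin' (I * fm * P) with hgdef
  have hg1 : ∀ w, g ∘ₗ W.ρ w = ((residueFieldCard F : E) ^ deg w) • (W.ρ w ∘ₗ g) := by
    intro w
    apply LinearMap.toMatrix'.injective
    rw [LinearMap.toMatrix'_comp, LinearEquiv.map_smul, LinearMap.toMatrix'_comp, hgdef,
      LinearMap.toMatrix'_toLin']
    calc I * fm * P * LinearMap.toMatrix' (W.ρ w)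
        = I * fm * (P * LinearMap.toMatrix' (W.ρ w)) := by simp only [Matrix.mul_assoc]
      _ = I * fm * (P * LinearMap.toMatrix' (W.ρ w) * I * P) := by
          rw [← mul_eq_compress_mul hPI (hρ w)]
      _ = I * (fm * (P * LinearMap.toMatrix' (W.ρ w) * I)) * P := by simp only [Matrix.mul_assoc]
      _ = ((residueFieldCard F : E) ^ deg w) •
            (I * (P * LinearMap.toMatrix' (W.ρ w) * I) * fm * P) := by
          rw [hf' w, Matrix.mul_smul, Matrix.smul_mul]
          simp only [Matrix.mul_assoc]
      _ = ((residueFieldCard F : E) ^ deg w) • (LinearMap.toMatrix' (W.ρ w) * (I * fm * P)) := by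
          rw [← mul_eq_mul_compress hPI (hρ w)]
          simp only [Matrix.mul_assoc]
  have hg2 : g ∘ₗ W.N = W.N ∘ₗ g := by
    apply LinearMap.toMatrix'.injective
    rw [LinearMap.toMatrix'_comp, LinearMap.toMatrix'_comp, hgdef, LinearMap.toMatrix'_toLin']
    calc I * fm * P * LinearMap.toMatrix' W.N
        = I * fm * (P * LinearMap.toMatrix' W.N) := by simp only [Matrix.mul_assoc]
      _ = I * fm * (P * LinearMap.toMatrix' W.N * I * P) := by rw [← mul_eq_compress_mul hPI hN]
      _ = I * (fm * (P * LinearMap.toMatrix' W.N * I)) * P := by simp only [Matrix.mul_assoc]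
      _ = I * (P * LinearMap.toMatrix' W.N * I) * fm * P := by
          rw [hfN']; simp only [Matrix.mul_assoc]
      _ = LinearMap.toMatrix' W.N * (I * fm * P) := by
          rw [← mul_eq_mul_compress hPI hN]; simp only [Matrix.mul_assoc]
  have hg0 : I * fm * P = 0 := by
    have h := congrArg LinearMap.toMatrix' (hgen g hg1 hg2)
    rwa [hgdef, LinearMap.toMatrix'_toLin', map_zero] at h
  have hfm0 : fm = 0 := by
    calc fm = P * I * fm * (P * I) := by rw [hPI, Matrix.one_mul, Matrix.mul_one]
      _ = P * (I * fm * P) * I := by simp only [Matrix.mul_assoc]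
      _ = 0 := by rw [hg0, Matrix.mul_zero, Matrix.zero_mul]
  exact LinearMap.toMatrix'.injective (by rw [← hfm, hfm0, map_zero])

/-! ### §5 Transfer of the Grothendieck–Deligne recipe to a summand -/

/-- **Recipe transfer.** Let `W` be attached to `R : W_F →* GL_m(E)` by the recipe
`IsWeilDeligneOfLadic` and let `ρ' : W_F →* GL_n(E)` be the summand of `R` cut out by `(I, P)`
(`P I = 1`, `R(w) I = I ρ'(w)`, `P R(w) = ρ'(w) P`).  Then some Weil–Deligne representation
on `Fin n → E` (the compression of `W`) is attached to `ρ'` by the recipe, and it is generic when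
`W` is.  The idempotent `e = I P` commutes with `N` by the key lemma `comm_of_comm_exp_smul`
applied to `R(u₀) = exp (t(u₀) N)`, `t(u₀) ≠ 0`. [cite: TateCorvallis1979, (4.2.1)] -/
theorem exists_isWeilDeligneOfLadic_of_summand {R : WeilGroup F →* GL (Fin m) E}
    {ρ' : WeilGroup F →* GL (Fin n) E} (hW : IsWeilDeligneOfLadic R W) (hPI : P * I = 1)
    (hRI : ∀ w, ((R w : GL (Fin m) E) : Matrix (Fin m) (Fin m) E) * I =
      I * ((ρ' w : GL (Fin n) E) : Matrix (Fin n) (Fin n) E))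
    (hPR : ∀ w, P * ((R w : GL (Fin m) E) : Matrix (Fin m) (Fin m) E) =
      ((ρ' w : GL (Fin n) E) : Matrix (Fin n) (Fin n) E) * P) :
    ∃ W' : WeilDeligneRep F E (Fin n → E), IsWeilDeligneOfLadic ρ' W' ∧
      ((∀ f : (Fin m → E) →ₗ[E] (Fin m → E),
          (∀ w : WeilGroup F, f ∘ₗ W.ρ w = ((residueFieldCard F : E) ^ (deg w)) • (W.ρ w ∘ₗ f)) →
            f ∘ₗ W.N = W.N ∘ₗ f → f = 0) →
        ∀ f : (Fin n → E) →ₗ[E] (Fin n → E),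
          (∀ w : WeilGroup F, f ∘ₗ W'.ρ w = ((residueFieldCard F : E) ^ (deg w)) • (W'.ρ w ∘ₗ f)) →
            f ∘ₗ W'.N = W'.N ∘ₗ f → f = 0) := by
  obtain ⟨t, U, Φ, hU, hUo, hΦ, ⟨u₀, hu₀U, ht₀⟩, h2, h3⟩ := hW
  set Nm := LinearMap.toMatrix' W.N with hNm
  have hNnil : IsNilpotent Nm := W.isNilpotent_N.map LinearMap.toMatrixAlgEquiv'
  -- `e = I P` commutes with every `R w`
  have heR : ∀ w, I * P * ((R w : GL (Fin m) E) : Matrix (Fin m) (Fin m) E) =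
      ((R w : GL (Fin m) E) : Matrix (Fin m) (Fin m) E) * (I * P) :=
    fun w => comm_of_intertwine (hRI w) (hPR w)
  have hPRI : ∀ w, P * ((R w : GL (Fin m) E) : Matrix (Fin m) (Fin m) E) * I =
      ((ρ' w : GL (Fin n) E) : Matrix (Fin n) (Fin n) E) :=
    fun w => compress_eq_of_mul_eq hPI (hRI w)
  -- `e` commutes with `N` (key lemma)
  have ht₀a : (t u₀).toAdd ≠ 0 := fun h => ht₀ (by rw [← ofAdd_toAdd (t u₀), h, ofAdd_zero])
  have heN : I * P * Nm = Nm * (I * P) := by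
    refine comm_of_comm_exp_smul (idem hPI) hNnil ht₀a ?_
    rw [← h2 u₀ hu₀U]
    exact heR u₀
  have heNs : ∀ u : inertia F, I * P * (-((t u).toAdd • Nm)) = -((t u).toAdd • Nm) * (I * P) :=
    fun u => comm_neg_smul (I * P) heN _
  -- the Weil action of `W` in terms of `R`: `ρ(w) = R(w) exp(-t(u) N)`, `u = Φ ^ deg w * w`
  have hWρ : ∀ w, ∃ u : inertia F, LinearMap.toMatrix' (W.ρ w) =
      ((R w : GL (Fin m) E) : Matrix (Fin m) (Fin m) E) * IsNilpotent.exp (-((t u).toAdd • Nm)) := by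
    intro w
    let u : inertia F := ⟨Φ ^ deg w * w, WeilGroup.zpow_deg_mul_mem_inertia hΦ w⟩
    have hw : Φ ^ (-deg w) * (u : WeilGroup F) = w := by
      rw [zpow_neg]
      exact inv_mul_cancel_left _ _
    refine ⟨u, ?_⟩
    have h := h3 (-deg w) u
    rwa [hw] at h
  have heρ : ∀ w, I * P * LinearMap.toMatrix' (W.ρ w) = LinearMap.toMatrix' (W.ρ w) * (I * P) := by
    intro w
    obtain ⟨u, hu⟩ := hWρ w
    rw [hu, ← Matrix.mul_assoc, heR w, Matrix.mul_assoc,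
      comm_exp (I * P) (heNs u) ((hNnil.smul _).neg), Matrix.mul_assoc]
  refine ⟨compress W I P hPI heρ heN, ⟨t, U, Φ, hU, hUo, hΦ, ⟨u₀, hu₀U, ht₀⟩, ?_, ?_⟩,
    isGeneric_compress W I P hPI heρ heN⟩
  · -- (2) on `U`: `ρ'(u) = exp (t(u) N')`
    intro u hu
    have hec : I * P * ((t u).toAdd • Nm) = ((t u).toAdd • Nm) * (I * P) := by
      rw [Matrix.mul_smul, Matrix.smul_mul, heN]
    rw [toMatrix'_compress_N, ← hPRI u, h2 u hu, compress_exp hPI hec (hNnil.smul _),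
      Matrix.mul_smul, Matrix.smul_mul]
  · -- (3) the formula `ρ_{W'}(Φ^m u) = ρ'(Φ^m u) exp(-t(u) N')`
    intro k u
    rw [toMatrix'_compress_ρ, toMatrix'_compress_N, h3 k u,
      compress_mul hPI _ (comm_exp (I * P) (heNs u) ((hNnil.smul _).neg)), hPRI,
      compress_exp hPI (heNs u) ((hNnil.smul _).neg), Matrix.mul_neg, Matrix.neg_mul,
      Matrix.mul_smul, Matrix.smul_mul]

end WD

end Summit.Langlands.Langlands.Theorems.EisensteinMonodromyEnvelopeCompression

end
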